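import Literature.Geometry.Riemannian.RoundCylinderFour
import Literature.Geometry.Riemannian.ConformalHessian
import HarnessLib

/-!
# The round cylinder `S³(2) × ℝ ≅ (ℝ⁴ ∖ 0, 4|y|⁻² δ)`: the shrinking soliton structure
(topic `Geometry/Riemannian`)

Second file of the round-cylinder model (see `RoundCylinderFour.lean`). With the potential
`f = (log |y|)² + 3/2 = z²/4 + 3/2` (`z = 2 log |y|` the height):

* `LE = log |y|`, `fE`, `fP` — the potential and its calculus (`fderiv_fE_apply`,
  `fderiv_fderiv_fE_apply`), smoothness `contMDiff_fP`;
* `rP = e^{u} = 2/|y|` (`g_c = r² δ`) and **`hessian_cylP_fP_self`** —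
  `Hess_{g_c} f (u,u) = 2⟪x,u⟫²/|x|⁴ = ½ dz(u)²`, from the conformal law of the Hessian
  (`GGSU.hessian_conformal_apply_self`, `ConformalHessian.lean`);
* **`soliton`** — `Ric(g_c) + Hess_{g_c} f = ½ g_c` (polarisation of the diagonal identity);
* **`gradSq_cylP_fP`** (`|∇f|² = (log|y|)²`), **`normalisation`** (`R + |∇f|² = f`),
  `scalarCurvature_ne_zero` (`R = 3/2 ≠ 0`); `NoncompactSpace P4`, `ConnectedSpace P4`.

So `(ℝ⁴ ∖ 0, g_c, f)` is a normalised gradient shrinking Ricci soliton (Cao–Hamilton–Ilmanen 2004,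
§4; Petersen 2016, §4.2.3). Everything is proved; no named facts.

## References

* H.-D. Cao, R. S. Hamilton, T. Ilmanen, arXiv:math/0404165 (2004), §4. [CaoHamiltonIlmanen2004]
* B. O'Neill, *Semi-Riemannian geometry*, 1983, Ch. 3, Def. 3.48 (Hessian). [ONeill1983]
-/

noncomputable section

open Bundle Set Function Filter Manifold Metric Module TopologicalSpace
open scoped Manifold ContDiff Topology RealInnerProductSpace ENNReal NNReal

namespace Literature.Geometry.Riemannian

open Lorentzian Lorentzian.PseudoRiemannianMetric

namespace RoundCylinderFour

/-! ### The potential `f = L² + 3/2`, `L = ½ log |y|² = log |y|` -/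

/-- `L(y) = log |y|` (as `log 2 − u`, to reuse the calculus of `u`). [folklore] -/
def LE (y : EuclideanFour) : ℝ := Real.log 2 - uE y

/-- The shrinker potential of the cylinder: `f = (log|y|)² + 3/2 = z²/4 + 3/2`, `z = 2 log |y|`. [folklore] -/
def fE (y : EuclideanFour) : ℝ := LE y ^ 2 + 3 / 2

/-- The potential on the punctured space. [folklore] -/
def fP (y : P4) : ℝ := fE y

/-- Support lemma `fP_eq` of the round-cylinder model `(ℝ⁴∖0, 4|y|⁻²δ)` (see the module docstring). [folklore] -/
theorem fP_eq (y : P4) : fP y = fE y := rfl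

/-- Support lemma `LE_eq_log` of the round-cylinder model `(ℝ⁴∖0, 4|y|⁻²δ)` (see the module docstring). [folklore] -/
theorem LE_eq_log {y : EuclideanFour} (hy : y ≠ 0) : LE y = Real.log ‖y‖ := by
  have hy' : 0 < ‖y‖ := norm_pos_iff.mpr hy
  rw [LE, uE, Real.log_pow]; push_cast; ring

/-- Support lemma `contDiffAt_LE` of the round-cylinder model `(ℝ⁴∖0, 4|y|⁻²δ)` (see the module docstring). [folklore] -/
theorem contDiffAt_LE {y : EuclideanFour} (hy : y ≠ 0) {n : ℕ∞ω} : ContDiffAt ℝ n LE y :=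
  contDiffAt_const.sub (contDiffAt_uE hy)

/-- Support lemma `contDiffAt_fE` of the round-cylinder model `(ℝ⁴∖0, 4|y|⁻²δ)` (see the module docstring). [folklore] -/
theorem contDiffAt_fE {y : EuclideanFour} (hy : y ≠ 0) {n : ℕ∞ω} : ContDiffAt ℝ n fE y :=
  ((contDiffAt_LE hy).pow 2).add contDiffAt_const

/-- Support lemma `contMDiff_fP` of the round-cylinder model `(ℝ⁴∖0, 4|y|⁻²δ)` (see the module docstring). [folklore] -/
theorem contMDiff_fP : ContMDiff 𝓘(ℝ, EuclideanFour) 𝓘(ℝ) ∞ fP := by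
  have h : ContDiffOn ℝ ∞ fE {y : EuclideanFour | y ≠ 0} := fun y hy ↦ (contDiffAt_fE hy).contDiffWithinAt
  exact h.contMDiffOn.comp_contMDiff contMDiff_subtype_val fun y ↦ coe_ne_zero y

/-- Support lemma `hasFDerivAt_LE` of the round-cylinder model `(ℝ⁴∖0, 4|y|⁻²δ)` (see the module docstring). [folklore] -/
theorem hasFDerivAt_LE {y : EuclideanFour} (hy : y ≠ 0) :
    HasFDerivAt LE ((‖y‖ ^ 2)⁻¹ • innerSL ℝ y) y := by
  have h := (hasFDerivAt_uE hy).const_sub (Real.log 2)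
  refine h.congr_fderiv ?_
  rw [neg_smul, neg_neg]

/-- Support lemma `fderiv_LE_apply` of the round-cylinder model `(ℝ⁴∖0, 4|y|⁻²δ)` (see the module docstring). [folklore] -/
theorem fderiv_LE_apply {y : EuclideanFour} (hy : y ≠ 0) (v : EuclideanFour) :
    fderiv ℝ LE y v = ⟪y, v⟫ / ‖y‖ ^ 2 := by
  rw [(hasFDerivAt_LE hy).fderiv, smul_apply, innerSL_apply_apply, smul_eq_mul]
  ring

/-- Support lemma `hasFDerivAt_fE` of the round-cylinder model `(ℝ⁴∖0, 4|y|⁻²δ)` (see the module docstring). [folklore] -/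
theorem hasFDerivAt_fE {y : EuclideanFour} (hy : y ≠ 0) :
    HasFDerivAt fE ((2 * LE y * (‖y‖ ^ 2)⁻¹) • innerSL ℝ y) y := by
  have h := ((hasFDerivAt_LE hy).pow 2).add_const (3 / 2 : ℝ)
  refine h.congr_fderiv ?_
  ext v
  simp only [smul_apply, innerSL_apply_apply, smul_eq_mul, nsmul_eq_mul, Nat.cast_ofNat,
    pow_one, Nat.add_one_sub_one]
  ring

/-- Support lemma `fderiv_fE_apply` of the round-cylinder model `(ℝ⁴∖0, 4|y|⁻²δ)` (see the module docstring). [folklore] -/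
theorem fderiv_fE_apply {y : EuclideanFour} (hy : y ≠ 0) (v : EuclideanFour) :
    fderiv ℝ fE y v = 2 * LE y * ⟪y, v⟫ / ‖y‖ ^ 2 := by
  rw [(hasFDerivAt_fE hy).fderiv, smul_apply, innerSL_apply_apply, smul_eq_mul]
  ring

/-- `D²(LE) = −D²u`. [folklore] -/
theorem fderiv_fderiv_LE_apply {x : EuclideanFour} (hx : x ≠ 0) (Y Z : EuclideanFour) :
    fderiv ℝ (fderiv ℝ LE) x Y Z = ⟪Y, Z⟫ / ‖x‖ ^ 2 - 2 * ⟪x, Y⟫ * ⟪x, Z⟫ / ‖x‖ ^ 4 := by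
  have hev : fderiv ℝ LE =ᶠ[𝓝 x] fun y ↦ -fderiv ℝ uE y := by
    filter_upwards [isOpen_compl_singleton.mem_nhds hx] with y hy
    rw [(hasFDerivAt_LE hy).fderiv, (hasFDerivAt_uE hy).fderiv, neg_smul, neg_neg]
  rw [hev.fderiv_eq, fderiv_fun_neg, neg_apply, neg_apply, fderiv_fderiv_uE_apply hx]
  ring

/-- `D²f(Y,Z) = 2 dL(Y) dL(Z) + 2 L D²L(Y,Z)`. [folklore] -/
theorem fderiv_fderiv_fE_apply {x : EuclideanFour} (hx : x ≠ 0) (Y Z : EuclideanFour) :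
    fderiv ℝ (fderiv ℝ fE) x Y Z =
      2 * (⟪x, Y⟫ / ‖x‖ ^ 2) * (⟪x, Z⟫ / ‖x‖ ^ 2) +
        2 * LE x * (⟪Y, Z⟫ / ‖x‖ ^ 2 - 2 * ⟪x, Y⟫ * ⟪x, Z⟫ / ‖x‖ ^ 4) := by
  -- `dfE = (2 L) • dL` near `x`
  have hev : fderiv ℝ fE =ᶠ[𝓝 x] fun y ↦ (2 * LE y) • fderiv ℝ LE y := by
    filter_upwards [isOpen_compl_singleton.mem_nhds hx] with y hy
    rw [(hasFDerivAt_fE hy).fderiv, (hasFDerivAt_LE hy).fderiv, smul_smul]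
  have hL : DifferentiableAt ℝ (fun y ↦ 2 * LE y) x :=
    (differentiableAt_const _).mul (hasFDerivAt_LE hx).differentiableAt
  have hdL : DifferentiableAt ℝ (fderiv ℝ LE) x := by
    have hc : ContDiffAt ℝ 2 LE x := contDiffAt_LE hx
    exact (hc.fderiv_right (m := 1) (by norm_num)).differentiableAt one_ne_zero
  rw [hev.fderiv_eq, fderiv_fun_smul hL hdL]
  simp only [add_apply, smul_apply, smul_eq_mul, ContinuousLinearMap.smulRight_apply]
  rw [fderiv_fderiv_LE_apply hx, fderiv_const_mul (hasFDerivAt_LE hx).differentiableAt, smul_apply,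
    smul_eq_mul, fderiv_LE_apply hx, fderiv_LE_apply hx]
  ring


/-! ### The conformal factor `r = e^{u} = 2/|y|` and the Hessian of `f` for `g_c` -/

/-- `r = e^u` (`= 2/|y|`), so that `g_c = r² δ`. [folklore] -/
def rP (y : P4) : ℝ := Real.exp (uE y)

/-- Support lemma `rP_pos` of the round-cylinder model `(ℝ⁴∖0, 4|y|⁻²δ)` (see the module docstring). [folklore] -/
theorem rP_pos (y : P4) : 0 < rP y := Real.exp_pos _

/-- Support lemma `rP_sq` of the round-cylinder model `(ℝ⁴∖0, 4|y|⁻²δ)` (see the module docstring). [folklore] -/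
theorem rP_sq (y : P4) : rP y ^ 2 = Real.exp (2 * uE (y : EuclideanFour)) := by
  rw [rP, sq, ← Real.exp_add]; ring_nf

/-- Support lemma `cylP_val_eq_rP_sq` of the round-cylinder model `(ℝ⁴∖0, 4|y|⁻²δ)` (see the module docstring). [folklore] -/
theorem cylP_val_eq_rP_sq (y : P4) : cylP.val y = rP y ^ 2 • flatP.val y := by
  rw [rP_sq]; rfl

/-- Support lemma `hasFDerivAt_exp_uE` of the round-cylinder model `(ℝ⁴∖0, 4|y|⁻²δ)` (see the module docstring). [folklore] -/
theorem hasFDerivAt_exp_uE {y : EuclideanFour} (hy : y ≠ 0) :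
    HasFDerivAt (fun y ↦ Real.exp (uE y)) (Real.exp (uE y) • (-(‖y‖ ^ 2)⁻¹ • innerSL ℝ y)) y :=
  (Real.hasDerivAt_exp _).comp_hasFDerivAt y (hasFDerivAt_uE hy)

/-- Support lemma `mdifferentiableAt_rP` of the round-cylinder model `(ℝ⁴∖0, 4|y|⁻²δ)` (see the module docstring). [folklore] -/
theorem mdifferentiableAt_rP (x : P4) :
    MDifferentiableAt 𝓘(ℝ, EuclideanFour) 𝓘(ℝ, ℝ) rP x := by
  have h : ContDiffOn ℝ ∞ (fun y ↦ Real.exp (uE y)) {y : EuclideanFour | y ≠ 0} :=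
    Real.contDiff_exp.comp_contDiffOn contDiffOn_uE
  have h2 : ContMDiff 𝓘(ℝ, EuclideanFour) 𝓘(ℝ) ∞ rP :=
    h.contMDiffOn.comp_contMDiff contMDiff_subtype_val fun y ↦ coe_ne_zero y
  exact h2.mdifferentiableAt (by simp)

/-- Support lemma `mvfderiv_rP` of the round-cylinder model `(ℝ⁴∖0, 4|y|⁻²δ)` (see the module docstring). [folklore] -/
theorem mvfderiv_rP (x : P4) (u : EuclideanFour) :
    mvfderiv 𝓘(ℝ, EuclideanFour) rP x u =
      rP x * (-⟪(x : EuclideanFour), u⟫ / ‖(x : EuclideanFour)‖ ^ 2) := by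
  have hx := coe_ne_zero x
  rw [OpensChart.mvfderiv_eq x rP (fun y ↦ Real.exp (uE y)) (fun _ ↦ rfl)
    (hasFDerivAt_exp_uE hx).differentiableAt u, (hasFDerivAt_exp_uE hx).fderiv]
  simp only [smul_apply, smul_eq_mul, innerSL_apply_apply, rP]
  ring

/-- Support lemma `mvfderiv_fP` of the round-cylinder model `(ℝ⁴∖0, 4|y|⁻²δ)` (see the module docstring). [folklore] -/
theorem mvfderiv_fP (x : P4) (u : EuclideanFour) :
    mvfderiv 𝓘(ℝ, EuclideanFour) fP x u =
      2 * LE x * ⟪(x : EuclideanFour), u⟫ / ‖(x : EuclideanFour)‖ ^ 2 := by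
  have hx := coe_ne_zero x
  rw [OpensChart.mvfderiv_eq x fP fE fP_eq (hasFDerivAt_fE hx).differentiableAt u, fderiv_fE_apply hx]

/-- Support lemma `sharp_flatP` of the round-cylinder model `(ℝ⁴∖0, 4|y|⁻²δ)` (see the module docstring). [folklore] -/
theorem sharp_flatP (x : P4) (α : EuclideanFour →L[ℝ] ℝ) :
    flatP.sharp x (α : EuclideanFour →ₗ[ℝ] ℝ) = ∑ i, α (e4 i) • e4 i := by
  rw [OpensChart.sharp_eq_sharpAt flatP_val x α,
    MetricCoord.sharpAt_constMetric _ e4 innerSL_basisFun_orthonormal (fun v w ↦ real_inner_comm w v)]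

/-- Support lemma `contMDiffAt_two_fP` of the round-cylinder model `(ℝ⁴∖0, 4|y|⁻²δ)` (see the module docstring). [folklore] -/
theorem contMDiffAt_two_fP (x : P4) : ContMDiffAt 𝓘(ℝ, EuclideanFour) 𝓘(ℝ, ℝ) 2 fP x :=
  (contMDiff_fP.of_le (by norm_cast)).contMDiffAt

/-- `d(fP) = d(fE)` as continuous linear maps (the tangent space of the open subset is `ℝ⁴`). [folklore] -/
theorem mvfderiv_fP_eq (x : P4) :
    mvfderiv 𝓘(ℝ, EuclideanFour) fP x = (fderiv ℝ fE x : EuclideanFour →L[ℝ] ℝ) := by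
  apply ContinuousLinearMap.ext; intro v
  exact OpensChart.mvfderiv_eq x fP fE fP_eq (hasFDerivAt_fE (coe_ne_zero x)).differentiableAt v

/-- The position vector as a tangent vector at `x`. [folklore] -/
def pos (x : P4) : TangentSpace 𝓘(ℝ, EuclideanFour) x :=
  show EuclideanFour from (x : EuclideanFour)

/-- `♯_δ (drP) = −(r/|x|²) x`. [folklore] -/
theorem sharp_flatP_mvfderiv_rP (x : P4) :
    flatP.sharp x (mvfderiv 𝓘(ℝ, EuclideanFour) rP x).toLinearMap =
      (-(rP x) / ‖(x : EuclideanFour)‖ ^ 2) • pos x := by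
  refine flatP.sharp_eq_of_forall x _ _ fun w ↦ ?_
  rw [map_smul, smul_apply, smul_eq_mul]
  change _ * ⟪(x : EuclideanFour), w⟫ = mvfderiv 𝓘(ℝ, EuclideanFour) rP x w
  rw [mvfderiv_rP]
  ring

/-- **The `g_c`-Hessian of the potential on the diagonal**: `Hess_{g_c} f (u,u) = 2⟪x,u⟫²/|x|⁴`
(`= ½ dz(u)²`, `dz = 2⟪x,·⟫/|x|²`). [folklore] -/
theorem hessian_cylP_fP_self (x : P4) (u : TangentSpace 𝓘(ℝ, EuclideanFour) x) :
    cylP.hessian fP x u u = 2 * ⟪(x : EuclideanFour), u⟫ ^ 2 / ‖(x : EuclideanFour)‖ ^ 4 := by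
  have hx := coe_ne_zero x
  have hn : ‖(x : EuclideanFour)‖ ≠ 0 := (norm_pos x).ne'
  have hr : rP x ≠ 0 := (rP_pos x).ne'
  have h := GGSU.hessian_conformal_apply_self (g := flatP) (ĝ := cylP) (r := rP) (x := x)
    cylP_val_eq_rP_sq (mdifferentiableAt_rP x) hr (contMDiffAt_two_fP x) u
  have hxx : mvfderiv 𝓘(ℝ, EuclideanFour) fP x (pos x) = 2 * LE x := by
    rw [mvfderiv_fP]
    change 2 * LE x * ⟪(x : EuclideanFour), (x : EuclideanFour)⟫ / ‖(x : EuclideanFour)‖ ^ 2 = _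
    rw [real_inner_self_eq_norm_sq]
    field_simp
  rw [sharp_flatP_mvfderiv_rP, map_smul, smul_eq_mul, hxx, mvfderiv_fP, mvfderiv_rP,
    hessian_flatP x fP_eq (contDiffAt_fE hx), fderiv_fderiv_fE_apply hx, flatP_apply] at h
  rw [h]
  field_simp
  ring

/-! ### The soliton equation `Ric + Hess f = ½ g_c` -/

/-- Support lemma `soliton_self` of the round-cylinder model `(ℝ⁴∖0, 4|y|⁻²δ)` (see the module docstring). [folklore] -/
theorem soliton_self (x : P4) (u : TangentSpace 𝓘(ℝ, EuclideanFour) x) :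
    cylP.ricci x u u + cylP.hessian fP x u u = (1 / 2 : ℝ) * cylP.val x u u := by
  have hn : ‖(x : EuclideanFour)‖ ≠ 0 := (norm_pos x).ne'
  rw [ricci_cylP, hessian_cylP_fP_self, cylP_apply]
  field_simp
  ring

/-- **The round cylinder is a gradient shrinking soliton**: `Ric(g_c) + Hess_{g_c} f = ½ g_c` on
`ℝ⁴ ∖ {0}`, `f = (log|y|)² + 3/2` (polarisation of `soliton_self`). [folklore] -/
theorem soliton (x : P4) (X Y : TangentSpace 𝓘(ℝ, EuclideanFour) x) :
    cylP.ricci x X Y + cylP.hessian fP x X Y = (1 / 2 : ℝ) * cylP.val x X Y := by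
  have h1 := soliton_self x (X + Y)
  have h2 := soliton_self x X
  have h3 := soliton_self x Y
  simp only [map_add, LinearMap.add_apply, add_apply] at h1
  have hRs : cylP.ricci x Y X = cylP.ricci x X Y :=
    (cylP.ricci_symm_holds (by norm_cast) x).eq Y X
  have hHs : cylP.hessian fP x Y X = cylP.hessian fP x X Y :=
    (cylP.hessian_symm_holds (contMDiffAt_two_fP x)).eq Y X
  have hgs : cylP.val x Y X = cylP.val x X Y := cylP.symm x Y X
  rw [hRs, hHs, hgs] at h1
  linarith

/-! ### `|∇f|²_{g_c} = L²` and the normalisation `R + |∇f|² = f` -/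

/-- Support lemma `gradSq_cylP_fP` of the round-cylinder model `(ℝ⁴∖0, 4|y|⁻²δ)` (see the module docstring). [folklore] -/
theorem gradSq_cylP_fP (x : P4) : cylP.gradSq fP x = LE x ^ 2 := by
  have hx := coe_ne_zero x
  have hn : ‖(x : EuclideanFour)‖ ≠ 0 := (norm_pos x).ne'
  have hc : Real.exp (2 * uE (x : EuclideanFour)) ≠ 0 := (Real.exp_pos _).ne'
  rw [PseudoRiemannianMetric.gradSq, mvfderiv_fP_eq, OpensChart.innerDual_eq_sharpAt (G := Gc) cylP_val x]
  have hsh : MetricCoord.sharpAt Gc x (fderiv ℝ fE x) =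
      (Real.exp (2 * uE (x : EuclideanFour)))⁻¹ • MetricCoord.sharpAt G0 x (fderiv ℝ fE x) :=
    MetricCoord.sharpAt_conformal (G := G0) (c := fun y ↦ Real.exp (2 * uE y))
      (OpensChart.isInvertible_repr flatP_val x)
      (OpensChart.isInvertible_repr (G := Gc) cylP_val x) hc _
  rw [hsh, map_smul, smul_eq_mul,
    MetricCoord.apply_sharpAt_constMetric _ e4 innerSL_basisFun_orthonormal
      (fun v w ↦ real_inner_comm w v), exp_two_uE hx]
  have hterm : ∀ i, fderiv ℝ fE x (e4 i) * fderiv ℝ fE x (e4 i)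
      = (4 * LE x ^ 2 / ‖(x : EuclideanFour)‖ ^ 4) * ⟪(x : EuclideanFour), e4 i⟫ ^ 2 := by
    intro i; rw [fderiv_fE_apply hx]; field_simp; ring
  simp_rw [hterm, ← Finset.mul_sum, sum_inner_e4_sq]
  field_simp

/-- **The normalisation** `R + |∇f|² = f` for the cylinder. [folklore] -/
theorem normalisation (x : P4) : cylP.scalarCurvature x + cylP.gradSq fP x = fP x := by
  rw [scalarCurvature_cylP, gradSq_cylP_fP, fP_eq, fE]
  ring

/-- The cylinder is not scalar-flat: `R = 3/2 ≠ 0`. [folklore] -/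
theorem scalarCurvature_ne_zero (x : P4) : cylP.scalarCurvature x ≠ 0 := by
  rw [scalarCurvature_cylP]; norm_num

section Topology

/-- Support lemma `instance` of the round-cylinder model `(ℝ⁴∖0, 4|y|⁻²δ)` (see the module docstring). [folklore] -/
instance : NoncompactSpace P4 := by
  refine ⟨fun hc ↦ ?_⟩
  have hK : IsCompact ((Subtype.val : P4 → EuclideanFour) '' univ) := hc.image continuous_subtype_val
  rw [image_univ, Subtype.range_coe_subtype] at hK
  have hb : Bornology.IsBounded ({(0 : EuclideanFour)}ᶜ : Set EuclideanFour) := hK.isBounded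
  have huniv : Bornology.IsBounded (univ : Set EuclideanFour) := by
    rw [← compl_union_self {(0 : EuclideanFour)}]
    exact hb.union Bornology.isBounded_singleton
  exact NormedSpace.unbounded_univ ℝ EuclideanFour huniv

/-- Support lemma `instance` of the round-cylinder model `(ℝ⁴∖0, 4|y|⁻²δ)` (see the module docstring). [folklore] -/
instance : ConnectedSpace P4 := by
  have h : IsConnected ({(0 : EuclideanFour)}ᶜ : Set EuclideanFour) := by
    refine isConnected_compl_singleton_of_one_lt_rank ?_ 0
    rw [← Module.finrank_eq_rank, finrank_euclideanSpace_fin]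
    norm_num
  exact isConnected_iff_connectedSpace.mp h

end Topology

end RoundCylinderFour

end Literature.Geometry.Riemannian

end
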